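import Literature.NumberTheory.GaloisRepresentations.RootsOfUnityInverseLimit
import Literature.AnabelianGeometry.AbsoluteAnabelian.AbsAnabProp121viiInvariantMapProofs
import Literature.AnabelianGeometry.AbsoluteAnabelian.AbsAnabProp121viiLevelCompatProofs
import Literature.AnabelianGeometry.AbsoluteAnabelian.ZHatCompletionFreeProcyclic
import Literature.AnabelianGeometry.AbsoluteAnabelian.AbsTopIII.GeometricCyclotome
import Literature.AnabelianGeometry.EtaleTheta.ZHatLevelDetermination
import HarnessLib

/-!
# `H²(G_K, Ẑ(1)) ≅ Ẑ` for a `p`-adic local field, via the invariant maps of local class field theory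

For a non-archimedean local field `K` of characteristic `0`: the invariant (residue) maps
`inv_n : H²(G_K, μ_n) ⥲ ℤ/nℤ` of local class field theory ([AbsAnab] Prop. 1.2.1 (vii) p. 11 "the residue
map `H²(Kᵢ, μ_{ℚ/ℤ}(K̄ᵢ)) ⥲ ℚ/ℤ`"; Serre, *Local Fields* XIII §3; in the tree `Prop121vii.IsInvariantMap`,
existing and unique by `Prop121vii.existsUniqueInvariantMap_holds`, compatible with `μ_n ⊆ μ_N` by
`Prop121vii.invariantMap_muInclHom_compat`) are compatible with the POWER maps `μ_m ↠ μ_n` as well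
(`castHom ∘ inv_m = inv_n ∘ H²(pow)`, `invariantMap_pow_compat`), hence assemble to an isomorphism of
the inverse limit `lim_n H²(G_K, μ_n)` of `RootsOfUnityInverseLimit.lean` with `lim_n ℤ/nℤ = Ẑ`
(Mathlib's profinite completion of `ℤ`, presented by its levels `ZHatLevel.level n`):

* `cohomologyLimitMuEquivZHat K : lim_n H²(G_K, μ_n) ≃+ Additive Ẑ`;
* with `H²_cont(G_K, Ẑ(1)) ≃+ lim_n H²(G_K, μ_n)` (NSW II §7 Thm. 2.7.5, `continuousCohomologyTwoTateModuleEquiv`)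
  and `Ẑ ≃ ∏_p ℤ_p` (`ZHatCompletion.exists_continuousMulEquiv_padicProd`):
  **`continuousCohomology 2 (Ẑ(1)) ≃+ AbsTopIII.ZHatCoeff`** (`nonempty_continuousCohomologyTwoTateModule_equiv_zhat`)
  — the coefficient-level content of [AbsTopIII] Cor. 1.10 (i)(a) p. 42 "`H²(G_k, μ_Ẑ(G_k)) ⥲ Ẑ`".

Proof-only w.r.t. the invariant-map files (definitions with bodies + theorems; no named fact, no `sorry`).
Cell abc-iut, layer L4 (LCFT lane).
-/

noncomputable section

open CategoryTheory Function
open Field IsNonarchimedeanLocalField ValuativeRel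
open ProfiniteGrp ProfiniteGrp.ProfiniteCompletion

universe u

namespace Literature.AnabelianGeometry.AbsoluteAnabelian

open _root_.TopRep _root_.ContRepresentation _root_.ContinuousCohomology
open Literature.NumberTheory.GaloisRepresentations
open Literature.NumberTheory.GaloisRepresentations.DiscreteGaloisModule
open Literature.AnabelianGeometry.EtaleTheta Literature.AnabelianGeometry.EtaleTheta.ZHatLevel

/-! ### `H²(μ_n ⊆ μ_m) ∘ H²(μ_m ↠ μ_n) = (m/n)·` -/

section PowIncl

variable (K : Type u) [Field K] {n m : ℕ+}

/-- On continuous `2`-cocycles, `μ_m ↠ μ_n ⊆ μ_m` (power map then inclusion) is multiplication by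
`m/n`. [cite: NeukirchSchmidtWingberg2008, II §7 Thm 2.7.5] -/
theorem pullback_muInclHom_redCocycle₂ [CompactSpace (absoluteGaloisGroup K)] (h : (n : ℕ) ∣ m)
    (c : contTwoCocycles (mu K m).toTopRep) :
    contTwoCocycles.pullback (ContinuousMonoidHom.id _) (resIdHom (muInclHom K h))
      ((muSystem K).redCocycle₂ h c) = ((m : ℕ) / n) • c := by
  refine Subtype.ext (ContinuousMap.ext fun p => muVal_injective K m ?_)
  change muVal K m (muInclusion K h (muPowMap K h (c.1 p))) = muVal K m ((((m : ℕ) / n) • c.1) p)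
  rw [muVal_muInclusion, muVal_muPowMap, ContinuousMap.smul_apply, muVal_nsmul]

/-- **`H²(μ_n ⊆ μ_m) (H²(μ_m ↠ μ_n) y) = (m/n) · y`** on `H²(G_K, μ_m)`.
[cite: NeukirchSchmidtWingberg2008, II §7 Thm 2.7.5] -/
theorem cohomologyMap_muInclHom_redHom [CompactSpace (absoluteGaloisGroup K)] (h : (n : ℕ) ∣ m)
    (y : continuousCohomology 2 (mu K m).toTopRep) :
    cohomologyMap (muInclHom K h) 2 (cohomologyMap ((muSystem K).redHom h) 2 y) = ((m : ℕ) / n) • y := by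
  obtain ⟨c, rfl⟩ := twoCocycleClass_surjective _ y
  have h1 : cohomologyMap ((muSystem K).redHom h) 2 (twoCocycleClass (mu K m).toTopRep c) =
      twoCocycleClass (mu K n).toTopRep ((muSystem K).redCocycle₂ h c) :=
    (muSystem K).cohomologyMap_redHom_twoCocycleClass h c
  have h2 : cohomologyMap (muInclHom K h) 2
      (twoCocycleClass (mu K n).toTopRep ((muSystem K).redCocycle₂ h c)) =
      twoCocycleClass (mu K m).toTopRep (contTwoCocycles.pullback (ContinuousMonoidHom.id _)
        (resIdHom (muInclHom K h)) ((muSystem K).redCocycle₂ h c)) :=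
    cohomologyMap_twoCocycleClass _ _
  rw [h1, h2, pullback_muInclHom_redCocycle₂, ← twoCocycleClassₗ_apply, map_nsmul,
    twoCocycleClassₗ_apply]

end PowIncl

/-! ### The invariant maps are compatible with the power maps -/

section Local

variable (K : Type u) [Field K] [ValuativeRel K] [TopologicalSpace K] [IsNonarchimedeanLocalField K]
  [CharZero K]

/-- A chosen family of invariant maps `inv_n : H²(G_K, μ_n) ⥲ ℤ/n` (unique: `Prop121vii.existsUniqueInvariantMap_holds`).
[cite: MochizukiAbsAnab2004, Prop 1.2.1 (vii) p.11] -/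
def invMap (n : ℕ+) : galoisCohomology (mu K n) 2 →+ ZMod n :=
  haveI : NeZero (n : ℕ) := NeZero.of_pos n.pos
  haveI : Finite (MuCarrier K n) := finite_muCarrier K n
  (Prop121vii.existsUniqueInvariantMap_holds K n).exists.choose

/-- The chosen `inv_n` is an invariant map. [cite: MochizukiAbsAnab2004, Prop 1.2.1 (vii) p.11] -/
theorem isInvariantMap_invMap (n : ℕ+) :
    haveI : NeZero (n : ℕ) := NeZero.of_pos n.pos
    haveI : Finite (MuCarrier K n) := finite_muCarrier K n
    Prop121vii.IsInvariantMap K n (invMap K n) := by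
  haveI : NeZero (n : ℕ) := NeZero.of_pos n.pos
  haveI : Finite (MuCarrier K n) := finite_muCarrier K n
  exact (Prop121vii.existsUniqueInvariantMap_holds K n).exists.choose_spec

/-- `inv_n` is bijective. [cite: MochizukiAbsAnab2004, Prop 1.2.1 (vii) p.11] -/
theorem invMap_bijective (n : ℕ+) : Bijective (invMap K n) := by
  haveI : NeZero (n : ℕ) := NeZero.of_pos n.pos
  haveI : Finite (MuCarrier K n) := finite_muCarrier K n
  exact (isInvariantMap_invMap K n).1

/-- **The invariant maps commute with the power maps**: `inv_m(y) mod n = inv_n(H²(μ_m ↠ μ_n) y)` for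
`n ∣ m` (from the compatibility with `μ_n ⊆ μ_m` and `H²(⊆) ∘ H²(↠) = (m/n)·`).
[cite: MochizukiAbsAnab2004, Prop 1.2.1 (vii) p.11] -/
theorem invMap_red_compat {n m : ℕ+} (h : (n : ℕ) ∣ m) (y : galoisCohomology (mu K m) 2) :
    ZMod.castHom h (ZMod n) (invMap K m y) =
      invMap K n (cohomologyMap ((muSystem K).redHom h) 2 y) := by
  haveI : NeZero (n : ℕ) := NeZero.of_pos n.pos
  haveI : NeZero (m : ℕ) := NeZero.of_pos m.pos
  haveI : Finite (MuCarrier K n) := finite_muCarrier K n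
  haveI : Finite (MuCarrier K m) := finite_muCarrier K m
  haveI : CompactSpace (absoluteGaloisGroup K) := absoluteGaloisGroup_compactSpace K
  set x := cohomologyMap ((muSystem K).redHom h) 2 y with hx
  have hcompat := Prop121vii.invariantMap_muInclHom_compat K h (invMap K n) (invMap K m)
    (isInvariantMap_invMap K n) (isInvariantMap_invMap K m) x
  rw [hx, cohomologyMap_muInclHom_redHom] at hcompat
  have h3 : invMap K m ((((m : ℕ) / n : ℕ)) • y) = (((m : ℕ) / n : ℕ)) • invMap K m y :=
    map_nsmul _ _ _
  replace hcompat := h3.symm.trans hcompat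
  rw [nsmul_eq_mul, ← ZMod.natCast_zmod_val (invMap K m y), ← Nat.cast_mul,
    ZMod.natCast_eq_natCast_iff, mul_comm] at hcompat
  -- cancel `m/n` in the congruence modulo `m = n·(m/n)`
  have hcompat' : (invMap K m y).val * ((m : ℕ) / n) ≡ (invMap K n x).val * ((m : ℕ) / n)
      [MOD (n : ℕ) * ((m : ℕ) / n)] := by
    rwa [Nat.mul_div_cancel' h]
  have hmod : (invMap K m y).val ≡ (invMap K n x).val [MOD n] :=
    Nat.ModEq.mul_right_cancel' (Nat.div_pos (Nat.le_of_dvd m.pos h) n.pos).ne' hcompat'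
  rw [ZMod.castHom_apply, ZMod.cast_eq_val, (ZMod.natCast_eq_natCast_iff _ _ _).2 hmod,
    ZMod.natCast_zmod_val]

/-! ### `lim_n H²(G_K, μ_n) ≅ Ẑ` -/

/-- The compatible family `(inv_n x_n)_n ∈ lim_n ℤ/nℤ` of an element of `lim_n H²(G_K, μ_n)`.
[cite: MochizukiAbsAnab2004, Prop 1.2.1 (vii) p.11] -/
def levelFamilyOf (x : (muSystem K).cohomologyLimit 2) : LevelFamily where
  c n := invMap K n ((x : ∀ n, continuousCohomology 2 ((muSystem K).ρ n).toTopRep) n)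
  compat n N h := by
    rw [invMap_red_compat K h]
    exact congrArg (invMap K n) (x.2 h)

/-- The element of `Ẑ` with prescribed levels `c_n`. [cite: RibesZalesskii2010, Thm 2.7.1] -/
def zhatOfLevelFamily (f : LevelFamily) : completion (GrpCat.of (Multiplicative ℤ)) :=
  powEnd f (eta 1)

omit [ValuativeRel K] [TopologicalSpace K] [IsNonarchimedeanLocalField K] [CharZero K] in
/-- The levels of `zhatOfLevelFamily f` are the `c_n`. [cite: RibesZalesskii2010, Thm 2.7.1] -/
@[simp] theorem toAdd_level_zhatOfLevelFamily (f : LevelFamily) (n : ℕ+) :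
    Multiplicative.toAdd (level n (zhatOfLevelFamily f)) = f.c n := by
  rw [zhatOfLevelFamily, toAdd_level_powEnd, level_eta, toAdd_ofAdd, Int.cast_one, mul_one]

/-- **`lim_n H²(G_K, μ_n) → Ẑ`**, `x ↦` the element of `Ẑ` with levels `inv_n(x_n)`; additive.
[cite: MochizukiAbsAnab2004, Prop 1.2.1 (vii) p.11] -/
def cohomologyLimitMuToZHat :
    (muSystem K).cohomologyLimit 2 →+ Additive (completion (GrpCat.of (Multiplicative ℤ))) where
  toFun x := Additive.ofMul (zhatOfLevelFamily (levelFamilyOf K x))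
  map_zero' := by
    refine congrArg Additive.ofMul (ext_of_level fun n => Multiplicative.toAdd.injective ?_)
    rw [toAdd_level_zhatOfLevelFamily, map_one, toAdd_one]
    exact map_zero (invMap K n)
  map_add' x y := by
    change Additive.ofMul (zhatOfLevelFamily (levelFamilyOf K (x + y))) =
      Additive.ofMul (zhatOfLevelFamily (levelFamilyOf K x) * zhatOfLevelFamily (levelFamilyOf K y))
    refine congrArg Additive.ofMul (ext_of_level fun n => Multiplicative.toAdd.injective ?_)
    rw [map_mul, toAdd_mul, toAdd_level_zhatOfLevelFamily, toAdd_level_zhatOfLevelFamily,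
      toAdd_level_zhatOfLevelFamily]
    exact map_add (invMap K n) _ _

/-- Levels of the comparison map. [cite: MochizukiAbsAnab2004, Prop 1.2.1 (vii) p.11] -/
theorem toAdd_level_cohomologyLimitMuToZHat (x : (muSystem K).cohomologyLimit 2) (n : ℕ+) :
    Multiplicative.toAdd (level n (Additive.toMul (cohomologyLimitMuToZHat K x))) =
      invMap K n ((x : ∀ n, continuousCohomology 2 ((muSystem K).ρ n).toTopRep) n) :=
  toAdd_level_zhatOfLevelFamily (levelFamilyOf K x) n

/-- **`lim_n H²(G_K, μ_n) ≃ Ẑ`** (injective: the levels determine an element of `Ẑ` and each `inv_n` is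
injective; surjective: the levels of `z ∈ Ẑ` pulled back along the bijections `inv_n` form a compatible
family by `invMap_red_compat`). [cite: MochizukiAbsAnab2004, Prop 1.2.1 (vii) p.11] -/
theorem cohomologyLimitMuToZHat_bijective : Bijective (cohomologyLimitMuToZHat K) := by
  constructor
  · intro x y hxy
    refine Subtype.ext (funext fun n => (invMap_bijective K n).1 ?_)
    rw [← toAdd_level_cohomologyLimitMuToZHat, ← toAdd_level_cohomologyLimitMuToZHat, hxy]
  · intro z
    choose pre hpre using fun n : ℕ+ => (invMap_bijective K n).2
    let x : ∀ n : ℕ+, continuousCohomology 2 ((muSystem K).ρ n).toTopRep :=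
      fun n => pre n (Multiplicative.toAdd (level n (Additive.toMul z)))
    have hx : x ∈ (muSystem K).cohomologyLimit 2 := by
      intro n m h
      apply (invMap_bijective K n).1
      change invMap K n (cohomologyMap ((muSystem K).redHom h) 2 (pre m _)) = invMap K n (pre n _)
      rw [← invMap_red_compat K h, hpre, hpre]
      exact (LevelFamily.ofZHat (Additive.toMul z)).compat n m h
    refine ⟨⟨x, hx⟩, ?_⟩
    change Additive.ofMul _ = Additive.ofMul (Additive.toMul z)
    refine congrArg Additive.ofMul (ext_of_level fun n => Multiplicative.toAdd.injective ?_)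
    rw [toAdd_level_zhatOfLevelFamily]
    exact hpre n _

/-- **`lim_n H²(G_K, μ_n) ≃+ Ẑ`** (additively). [cite: MochizukiAbsAnab2004, Prop 1.2.1 (vii) p.11] -/
def cohomologyLimitMuEquivZHat :
    (muSystem K).cohomologyLimit 2 ≃+ Additive (completion (GrpCat.of (Multiplicative ℤ))) :=
  AddEquiv.ofBijective _ (cohomologyLimitMuToZHat_bijective K)

/-! ### `Ẑ ≅ ∏_p ℤ_p = ZHatCoeff` and the conclusion -/

omit [ValuativeRel K] [TopologicalSpace K] [IsNonarchimedeanLocalField K] [CharZero K] in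
/-- `Ẑ ≃+ ZHatCoeff` (additively; the cell's cyclotome coefficients `ULift (∏_p ℤ_p)`), from the structure
theorem `ZHatCompletion.exists_continuousMulEquiv_padicProd`. [cite: RibesZalesskii2010, Thm 2.7.1] -/
theorem nonempty_zhat_addEquiv_zhatCoeff :
    Nonempty (Additive (completion (GrpCat.of (Multiplicative ℤ))) ≃+ AbsTopIII.ZHatCoeff.{u}) := by
  obtain ⟨e, -⟩ := ZHatCompletion.exists_continuousMulEquiv_padicProd
  refine ⟨{ toFun := fun x => ULift.up (Multiplicative.toAdd (e (Additive.toMul x)))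
            invFun := fun y => Additive.ofMul (e.symm (Multiplicative.ofAdd (ULift.down y)))
            left_inv := fun x => by simp
            right_inv := fun y => by simp
            map_add' := fun x y => by
              change ULift.up (Multiplicative.toAdd (e (Additive.toMul x * Additive.toMul y))) = _
              rw [map_mul, toAdd_mul]
              rfl }⟩

/-- **`H²_cont(G_K, Ẑ(1)) ≅ Ẑ`** for a non-archimedean local field `K` of characteristic `0`: the
continuous cohomology of the Tate module `Ẑ(1) = lim_n μ_n(K̄)` is `≃+ ZHatCoeff` (NSW II §7 Thm 2.7.5 +
the invariant maps of local class field theory + `Ẑ ≅ ∏_p ℤ_p`).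
[cite: MochizukiAbsTopIII2015, Cor 1.10 (i) p.42] -/
theorem nonempty_continuousCohomologyTwoTateModule_equiv_zhat :
    Nonempty (continuousCohomology 2 (tateModuleMu K).toTopRep ≃+ AbsTopIII.ZHatCoeff.{u}) := by
  obtain ⟨e⟩ := nonempty_zhat_addEquiv_zhatCoeff.{u}
  exact ⟨((continuousCohomologyTwoTateModuleEquiv K).trans (cohomologyLimitMuEquivZHat K)).trans e⟩

end Local

end Literature.AnabelianGeometry.AbsoluteAnabelian
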